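import Literature.MathematicalPhysics.QuantumFieldTheory.Balaban1983to89.B5QGGQ145Factor
import Literature.MathematicalPhysics.QuantumFieldTheory.Balaban1983to89.B5Decay126

/-!
# `Balaban1983to89.B5QGGQ145Position` — the factors `G′Q′^*`, `Q′G′` of `P = G′Q′^*(Q′G′²Q′^*)^{−1}Q′G′`
# POSITIONED in the (1.126) engine's torus carrier: fibre counts, the fine/coarse metric comparison, and the
# hypotheses `hB`, `hBst`, `hG`, `hM` of `B5Decay126.decay126_torus` in the multiplier model

T. Bałaban, *Propagators and renormalization transformations for lattice gauge theories. I*, Commun. Math. Phys.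
**95**, 17–40 (1984) [Balaban1984PropagatorsI] (cell paper B5): p. 25–26 [PDF 9–10] ((1.44), (1.45) and the `γ₀, γ₁`
sentence), p. 38 [PDF 22] ((1.126), (1.128)); [2] = B4 = [Balaban1983RegularityDecay], Lemma 2.4.  Renders
`1984-cmp95-propagators-rt-I-p009/p010/p022-x2.png` (cell folder `b2b-balaban-ref1/pages/`) read as images by the b05
lineage.

CITATION HEADER (lean-in-tree rule 2026-08-18).  PRINTED, p. 38, verbatim: *"Let us write bounds for the operator ∂P∂^*.
They follow from the representation P = G′Q′^*(Q′G′²Q′^*)^{−1}Q′G′, from Lemma 2.4 of [2], and the representation (1.45)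
and the analyticity method of proving an exponential decay (see the proof of Lemma 2.4 in [2]). We obtain
|(∂P∂^*)_{μ,ν}(x, x′)| ≦ O(1)e^{−δ′₀|x−x′|}, (1.126)"*; and, same page: *"Defining 2δ₀ = min{⅓δ′₀, M₀^{−1}}, we
obtain |h_{z₁}K(h_{z₂})A| ≦ O(M₀^{−1})e^{−2δ₀|z₁−z₂|}(|∇A| + |A|). (1.128)"* (v1.1 DOCFIX: v1 printed here, as «verbatim», a
sentence «These inequalities together with (1.126), (1.122) give finally ‖h_z K(h_□ A)‖ ≦ …» that is NOT in print —
XREAD adv1-g31, cell census C-A36-1, objection O1; the render p022 re-read as an image by b05-g7; Lean unaffected) (the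
tree's NAMED leaves `B5.Kernel126_127Printed`, `B5.CommutatorEstimate128`; pv15's discharged torus forms
`B5Decay126.decay126_torus`, `B5Decay126.h128_of_constituents`).  P. 26, verbatim: *"there are positive constants γ₀, γ₁, in fact γ₀ dependent only on
d, γ₁ = a^{−2}, such that γ₀ ≦ Q′_kG′_k²Q′_k^* ≦ γ₁."*

WHAT THE CELL ALREADY HAS (imported, untouched).  pv15's (1.126) ENGINE `B5Decay126.decay126_torus` on the carrier
`B5TorusCover.UT N′` (`= B4Sect5Torus.TSite`, `dist = tdist`, the sup torus distance in lattice steps of the torus with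
periods `N′`): inputs = positioned real kernels `G, D, D′ : ι×ι`, `B : κ×ι`, `Bst : ι×κ` with `PosDecay` hypotheses
`hG hD hD′ hB hBst` at one rate `δ`, fibre counts `hm₁ hm₂` of the position maps, and `hM : QGQInverse.Coercive
(B·G·G·Bst) γ₀`; output = the decay of `D·G·Bst·(B·G·G·Bst)⁻¹·B·G·D′`; and its (1.128) form `h128_of_constituents` on
the vector-field carrier `ι = UT N′ × Fin (d+1)` (`πf = Prod.fst`).  b05-g7: the factors AS REAL MATRICES
`B5QGGQ145Factor.KRe n a N : Matrix (Idx (n·N)) (Idx N) ℝ` (`G′Q′^*`), `QGRe := ξ^{d+1}KReᵀ` (`Q′G′`) with `QGRe·1·1·KRe =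
qggqRe`, `coercive_factorised` (`hM`, from pv17's (1.45) strip bounds via `B5QGGQ145Bounds`), and the ENTRY decay
`KRe_decay` in b04's COARSE sup-metric `MultiPeriod.torusSupNorm N (coarse z − k)` (b04's
`kernel248_torusKernel_decay_torusMetric`, B4 Lemma 2.4 on the torus).  LOCATED GAP (cell census G-B5-37): (a) the
POSITIONING of the two index sets in `UT (n·N)` and the conversion coarse sup-metric → `PosDecay (dist on UT (n·N))`;
(b) the direction index of `h128_of_constituents`; (c) the engine call.

THIS FILE (journal node QGGQ-145-POSITION of the cell `pub-balaban`, unit b2b-balaban-b05-g7) closes (a), the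
scalar-to-vector-carrier part of (b), and (c), sorry-free:
* §1 **positions** `fineSite n N : Idx (n·N) → UT (n·N)` (the identity) and `corner n N : Idx N → UT (n·N)` (`k ↦ n·k`,
  the corner of the block over the unit-torus site `k`), injective, **`fibre_card_fineSite` / `fibre_card_corner`**
  (fibres `≤ 1`: the engine's `hm₁`, `hm₂`);
* §2 **the metric comparison** `circAbs_fine_le` (`dist(n·m + r, nNℤ) ≤ n·dist(m, Nℤ) + r`), `ccoord_fine_corner_le`,
  **`dist_fineSite_corner_le`**: `dist_{UT(n·N)}(z, n·k) ≤ n·torusSupNorm N (coarse z − k) + (n − 1)`, and its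
  exponential form `exp_coarse_le` (a coarse-rate-`κ/(d+1)` decay is a fine-rate-`κ/((d+1)n)` decay up to `e^{κ/(d+1)}`);
* §3 **`KRe_posDecay`** / **`QGRe_posDecay`**: `∃ κ > 0, C ≥ 0, ∀ n ≥ 1, a ∈ [a₋,a₊], N: PosDecay dist fineSite corner
  (KRe n a N) C (κ/((d+1)n))` and the transposed one for `QGRe` (pv15's `PosDecay.transpose/smul/const_mono`) — the
  engine's `hBst`, `hB` in the multiplier model; rate `κ/((d+1)n)` per fine step = `κ/(d+1)` per `ξ`-unit length,
  uniform in `k` and the volume;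
* §4 `posDecay_one` (`hG` for `G := 1`), **`inputs126_multiplier`** (the four hypotheses `hG hB hBst hM` at once, one
  rate, one constant);
* §5 **direction padding** `KReV`, `QGReV` on `UT (n·N) × Fin (d+1)` (a scalar carried on the component `0`),
  `QGReV_mul_KReV` (`= QGRe·KRe`), `QGReV_one_one_KReV` (`= qggqRe`), `KReV_posDecay`, `QGReV_posDecay` (positions
  `Prod.fst` / `corner`), **`inputs128_multiplier`**;
* §6 `OneV`, `inv_padded` (`(QGReV·1·1·KReV)⁻¹ = kerRe = Re 𝒢^M`, pv17's kernel), **`decay126_multiplier`**: (1.126) in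
  the torus multiplier model = `decay126_torus` with `hG hB hBst hM hm₁ hm₂` DISCHARGED — for `0 < a₋ ≤ a₊` there are
  `κ₀ > 0, C ≥ 0, γ₀ > 0` such that for all `n ≥ 1`, `a ∈ [a₋,a₊]`, `N`, and ANY `D, D′` on the vector-field carrier with
  `PosDecay` at rate `κ₀/((d+1)n)`, the kernel `D·1·KReV·(QGReV·1·1·KReV)⁻¹·QGReV·1·D′` (= `∂P∂^*`) has `PosDecay` with
  pv15's `torusConst126 (d+1) (d+1) 1 cD cD′ 1 C C γ₀ δ` / `torusRate126 …` (`decay126_multiplier_rate_pos`: rate `> 0`);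
* §7 **`h128_multiplier`**: pv15's `h128_of_constituents` — (1.128) on the torus — with the same discharge: the inputs
  LEFT are the vector-field Dirichlet operator `Dg`, the coefficient `a′` of `aQ^*Q`, and the `∂`-kernels `D, D′` with
  their decay.  NO coercivity and NO Green-function hypothesis remains in the torus-model (1.126)/(1.128) leaf.

DICTIONARY / HONEST SCOPE.  Units as in `B5QGGQ145Torus/Bounds/Factor` (`ξ`-lattice `T_ξ = Π_μ ℤ/(nN_μ)`, `n = L^k`,
unit torus `T₁ = Π_μ ℤ/N_μ`, `m² = 0`, `U = 1`).  (i) pv15's carrier for the FINE torus is `UT (n·N)` whose `dist` counts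
FINE lattice steps, so every INPUT rate here (the decay of the factor kernels `KRe`, `QGRe`, `D`, `D′`) is per fine step
(`κ₀/((d+1)n)`); in `ξ`-units of length this is the `k`-independent `κ₀/(d+1)`.  The OUTPUT rate of `decay126_multiplier` /
`h128_multiplier` is pv15's `torusRate126 … (κ₀/((d+1)n))`, which the Combes–Thomas engine `B5Decay126.decay126_torus`
makes polynomially SMALLER than its input rate (and `torusConst126 …` polynomially LARGER) as `n = L^k` grows: this leaf
reproduces the SHAPE of (1.126)/(1.128) in the torus multiplier model, NOT print's `k`-uniform `δ′₀` / *"The constant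
O(1) in (1.126) depends on d only"* (p. 38) — that uniformity is the paper's untyped "analyticity method" (cell census
G-B5-38 (e); v1.1 DOCFIX after XREAD adv1-g31 C-A36-1 remark R1: v1's clause «— the paper's δ′₀ "independent of k"»
conflated the input and output rates); pv15's cube size `M₀` is likewise in fine steps (`M₀ = M₀^{print}·n`, see
`B5AveragingTorus.h128_balaban_torus`).  (ii) The coarse site `y ∈ T₁^{(k)}` is positioned at the CORNER `n·y` of
its block (any point of the block would do up to `e^{δ(n−1)}` in the constant, absorbed here by `e^{κ/(d+1)}`).  (iii)
The operator `P` acts on SCALAR functions; on pv15's vector-indexed carrier a scalar is carried on the direction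
component `0` (`KReV`, `QGReV`), so the successor's `D` must be `((x,μ),(z,λ)) ↦ [λ = 0]·∂_μ(x,z)` (and `D′` its
adjoint form) for `D·1·KReV·(…)⁻¹·QGReV·1·D′` to be LITERALLY `∂P∂^*`; any other fixed component is equivalent.  (iv)
`a′` (the coefficient of `aQ^*Q` in `Δ_a`, (1.121)) is kept independent of the `a` of `G′_k`; the paper has one `a`.
NOT typed here (cell census G-B5-38): the `∂`-kernels `D, D′` themselves (forward lattice derivative on the fine torus and
its adjoint, finite range `1`, `PosDecay.of_finiteRange`) and the resulting parameter-free (1.128) leaf; the `η`-rescaling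
(D-b05g7.1 (i)); gauge fields `U ≠ 1`; `B5Projector144` by name.  Value = kernel certificate: the (1.126)/(1.128)
torus-model inputs `hG, hB, hBst, hM, hm₁, hm₂` discharged end-to-end from b04 (Lemma 2.4), pv17 ((1.45) strip bounds)
and b05-g7 (Gram factorisation), NOT summit progress.  Staged byte-identically under `HOME/lean/BalabanYm4/`.

Tags: 6 `[cite: …]` (`KRe_posDecay`, `QGRe_posDecay`, `inputs126_multiplier`, `inputs128_multiplier`,
`decay126_multiplier`, `h128_multiplier`: the statements that ARE the printed (1.126)/(1.128) inputs or conclusions),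
22 `[folklore]`.  No `sorry`, no new axioms; imports `B5QGGQ145Factor` (b05-g7) and `B5Decay126` (pv15) only.
-/

namespace Literature.MathematicalPhysics.QuantumFieldTheory.Balaban1983to89.B5QGGQ145Position

open Finset
open Literature.MathematicalPhysics.QuantumFieldTheory.Balaban1983to89.B4TorusKernel
open Literature.MathematicalPhysics.QuantumFieldTheory.Balaban1983to89.B4TorusKernel.MultiPeriod
open Literature.MathematicalPhysics.QuantumFieldTheory.Balaban1983to89.B4Green244
open Literature.MathematicalPhysics.QuantumFieldTheory.Balaban1983to89.B4Sect5Torus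
open Literature.MathematicalPhysics.QuantumFieldTheory.Balaban1983to89.B5TorusCover
open Literature.MathematicalPhysics.QuantumFieldTheory.Balaban1983to89.B5Decay126
open Literature.MathematicalPhysics.QuantumFieldTheory.Balaban1983to89.B5QGGQ145Bounds
open Literature.MathematicalPhysics.QuantumFieldTheory.Balaban1983to89.B5QGGQ145Factor
open scoped Real Matrix

noncomputable section

variable {d : ℕ}

/-! ### §1 Positions: fine sites and block corners in the carrier `UT (n·N)`; fibre counts -/

/-- **THE FINE SITES AS POINTS OF THE CARRIER**: the row index `Π_μ Fin (nN_μ)` of `KRe` IS the site type of pv15's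
carrier `B5TorusCover.UT (n·N)` (fine periods `n·N_μ`); the position map is the identity. [folklore] -/
def fineSite (n : ℕ) (N : Fin (d + 1) → ℕ) (z : Idx (fun i => n * N i)) : UT (fun i => n * N i) :=
  UT.ofSite (fun i => n * N i) z

/-- the corner `n·k` of the block over the unit-torus site `k`, as a fine torus site. [folklore] -/
def cornerSite (n : ℕ) [NeZero n] (N : Fin (d + 1) → ℕ) (k : Idx N) : TSite (d + 1) (fun i => n * N i) :=
  fun i => ⟨n * (k i : ℕ), mul_lt_mul_of_pos_left (k i).isLt (NeZero.pos n)⟩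

/-- **THE COARSE SITES AS POINTS OF THE CARRIER**: the unit-torus site `k ∈ Π_μ Fin N_μ` (column index of `KRe`, the
site `y ∈ T₁^{(k)}` of the paper) sits at the corner `n·k` of its block `B^k(y) ⊂ T_ξ`. [folklore] -/
def corner (n : ℕ) [NeZero n] (N : Fin (d + 1) → ℕ) (k : Idx N) : UT (fun i => n * N i) :=
  UT.ofSite (fun i => n * N i) (cornerSite n N k)

/-- the value of a corner coordinate. [folklore] -/
theorem cornerSite_val (n : ℕ) [NeZero n] (N : Fin (d + 1) → ℕ) (k : Idx N) (i : Fin (d + 1)) :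
    ((cornerSite n N k i : ℕ) : ℤ) = (n : ℤ) * toZ k i := by
  show (((n * (k i : ℕ) : ℕ)) : ℤ) = (n : ℤ) * ((k i : ℕ) : ℤ)
  push_cast
  ring

/-- `fineSite` is injective (it is the identity). [folklore] -/
theorem fineSite_injective (n : ℕ) (N : Fin (d + 1) → ℕ) : Function.Injective (fineSite (d := d) n N) :=
  fun _ _ h => h

/-- `corner` is injective (`n ≥ 1`). [folklore] -/
theorem corner_injective (n : ℕ) [NeZero n] (N : Fin (d + 1) → ℕ) : Function.Injective (corner (d := d) n N) := by
  intro k k' h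
  funext i
  have h1 : (cornerSite n N k i : ℕ) = (cornerSite n N k' i : ℕ) :=
    congrArg Fin.val (congrFun (congrArg (UT.toSite (fun i => n * N i)) h) i)
  exact Fin.ext (Nat.eq_of_mul_eq_mul_left (NeZero.pos n) h1)

/-- **FINE FIBRES HAVE ONE ELEMENT** (hypothesis `hm₁` of `decay126_torus` with `m₁ = 1`). [folklore] -/
theorem fibre_card_fineSite (n : ℕ) (N : Fin (d + 1) → ℕ) (y : UT (fun i => n * N i)) :
    ((Finset.univ.filter fun z : Idx (fun i => n * N i) => fineSite n N z = y).card : ℝ) ≤ (1 : ℕ) := by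
  have h : (Finset.univ.filter fun z : Idx (fun i => n * N i) => fineSite n N z = y).card ≤ 1 :=
    Finset.card_le_one.mpr fun a ha b hb =>
      fineSite_injective n N (((Finset.mem_filter.mp ha).2).trans ((Finset.mem_filter.mp hb).2).symm)
  exact_mod_cast h

/-- **COARSE FIBRES HAVE AT MOST ONE ELEMENT** (hypothesis `hm₂` of `decay126_torus` with `m₂ = 1`). [folklore] -/
theorem fibre_card_corner (n : ℕ) [NeZero n] (N : Fin (d + 1) → ℕ) (y : UT (fun i => n * N i)) :
    ((Finset.univ.filter fun k : Idx N => corner n N k = y).card : ℝ) ≤ (1 : ℕ) := by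
  have h : (Finset.univ.filter fun k : Idx N => corner n N k = y).card ≤ 1 :=
    Finset.card_le_one.mpr fun a ha b hb =>
      corner_injective n N (((Finset.mem_filter.mp ha).2).trans ((Finset.mem_filter.mp hb).2).symm)
  exact_mod_cast h

/-! ### §2 The fine/coarse metric comparison: `dist_{T_ξ}(z, n·k) ≤ n·|coarse(z) − k|_{T₁} + (n − 1)` -/

/-- one coordinate: `dist(n·m + r, nNℤ) ≤ n·dist(m, Nℤ) + r` for `0 ≤ r` (scaling `dist(n·m, nNℤ) = n·dist(m, Nℤ)` plus
subadditivity). [folklore] -/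
theorem circAbs_fine_le {n N : ℕ} (hn : 1 ≤ n) (hN : 1 ≤ N) (m r : ℤ) (hr : 0 ≤ r) :
    circAbs (n * N) (n * m + r) ≤ n * circAbs N m + r := by
  have hnN : 1 ≤ n * N := by simpa using Nat.mul_le_mul hn hN
  have hc' : (0 : ℤ) < (n : ℤ) := by exact_mod_cast hn
  have hmul : circAbs (n * N) ((n : ℤ) * m) = n * circAbs N m := by
    unfold circAbs
    rw [Nat.cast_mul, Int.mul_emod_mul_of_pos _ _ hc', ← mul_sub]
    rcases le_total (m % (N : ℤ)) ((N : ℤ) - m % (N : ℤ)) with h | h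
    · rw [min_eq_left h, min_eq_left (mul_le_mul_of_nonneg_left h hc'.le)]
    · rw [min_eq_right h, min_eq_right (mul_le_mul_of_nonneg_left h hc'.le)]
  calc circAbs (n * N) (n * m + r) ≤ circAbs (n * N) (n * m) + circAbs (n * N) r := circAbs_add_le hnN _ _
    _ ≤ n * circAbs N m + |r| := by rw [hmul]; exact add_le_add le_rfl (circAbs_le_abs hnN r)
    _ = n * circAbs N m + r := by rw [abs_of_nonneg hr]

/-- one coordinate of the comparison: the `i`-th circular distance between the fine site `z` and the corner `n·k` is
at most `n·dist(⌊z_i/n⌋ − k_i, N_iℤ) + (n − 1)`. [folklore] -/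
theorem ccoord_fine_corner_le (n : ℕ) [NeZero n] (hn1 : 1 ≤ n) {N : Fin (d + 1) → ℕ} (hN : ∀ i, 1 ≤ N i)
    (z : Idx (fun i => n * N i)) (k : Idx N) (i : Fin (d + 1)) :
    ((ccoord (fun i => n * N i) z (cornerSite n N k) i : ℕ) : ℤ)
      ≤ n * circAbs (N i) ((coarse n (toZ z) - toZ k) i) + ((n - 1 : ℕ) : ℤ) := by
  rw [ccoord_cast (fun j => by simpa using Nat.mul_le_mul hn1 (hN j))]
  have hdiv := Int.mul_ediv_add_emod (toZ z i) (n : ℤ)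
  have hq : (coarse n (toZ z) - toZ k) i = toZ z i / n - toZ k i := rfl
  have hzi : toZ z i = ((z i : ℕ) : ℤ) := rfl
  have hz : ((z i : ℕ) : ℤ) - ((cornerSite n N k i : ℕ) : ℤ)
      = n * ((coarse n (toZ z) - toZ k) i) + toZ z i % n := by
    rw [cornerSite_val, hq, mul_sub]
    linarith
  rw [hz]
  have hr0 : 0 ≤ toZ z i % n := Int.emod_nonneg _ (by exact_mod_cast (NeZero.ne n))
  have hrn : toZ z i % n < n := Int.emod_lt_of_pos _ (by exact_mod_cast NeZero.pos n)
  have h := circAbs_fine_le hn1 (hN i) ((coarse n (toZ z) - toZ k) i) _ hr0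
  have hsub : ((n - 1 : ℕ) : ℤ) = n - 1 := by omega
  linarith

/-- **THE METRIC COMPARISON**: in pv15's carrier `UT (n·N)` (sup torus distance in FINE lattice steps) the distance from a
fine site `z` to the corner of the block over `k` is at most `n·|coarse(z) − k|_{T₁} + (n − 1)`, `|·|_{T₁} =
MultiPeriod.torusSupNorm N` the unit-torus sup-distance of b04's decay estimates. [folklore] -/
theorem dist_fineSite_corner_le (n : ℕ) [NeZero n] (hn1 : 1 ≤ n) (N : Fin (d + 1) → ℕ) [∀ i, NeZero (N i)]
    (z : Idx (fun i => n * N i)) (k : Idx N) :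
    dist (fineSite n N z) (corner n N k) ≤ n * torusSupNorm N (coarse n (toZ z) - toZ k) + ((n - 1 : ℕ) : ℝ) := by
  have hN : ∀ i, 1 ≤ N i := UT.one_le N
  unfold fineSite corner
  rw [UT.dist_ofSite]
  unfold tdist
  obtain ⟨i, -, hi⟩ := Finset.exists_mem_eq_sup (Finset.univ : Finset (Fin (d + 1))) Finset.univ_nonempty
    (ccoord (fun i => n * N i) z (cornerSite n N k))
  rw [hi]
  have h1 : ((ccoord (fun i => n * N i) z (cornerSite n N k) i : ℕ) : ℝ)
      ≤ n * ((circAbs (N i) ((coarse n (toZ z) - toZ k) i) : ℤ) : ℝ) + ((n - 1 : ℕ) : ℝ) := by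
    exact_mod_cast ccoord_fine_corner_le n hn1 hN z k i
  have h2 : ((circAbs (N i) ((coarse n (toZ z) - toZ k) i) : ℤ) : ℝ) ≤ torusSupNorm N (coarse n (toZ z) - toZ k) :=
    Finset.le_sup' (fun j => ((circAbs (N j) ((coarse n (toZ z) - toZ k) j) : ℤ) : ℝ)) (Finset.mem_univ i)
  have hn0 : (0 : ℝ) ≤ n := Nat.cast_nonneg n
  nlinarith

/-- the exponential form of the comparison: a decay `e^{−(κ/(d+1))·T}` in the coarse distance `T` is a decay
`e^{κ/(d+1)}·e^{−(κ/((d+1)n))·D}` in any fine distance `D ≤ nT + (n − 1)`. [folklore] -/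
theorem exp_coarse_le {κ : ℝ} (hκ : 0 ≤ κ) (d : ℕ) {n : ℕ} (hn : 1 ≤ n) {D T : ℝ}
    (hDT : D ≤ n * T + ((n - 1 : ℕ) : ℝ)) :
    Real.exp (-(κ / (d + 1) * T)) ≤ Real.exp (κ / (d + 1)) * Real.exp (-(κ / ((d + 1) * n) * D)) := by
  rw [← Real.exp_add]
  apply Real.exp_le_exp.mpr
  have hn' : (0 : ℝ) < n := by exact_mod_cast hn
  have hsub : ((n - 1 : ℕ) : ℝ) = n - 1 := by rw [Nat.cast_sub hn, Nat.cast_one]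
  rw [hsub] at hDT
  have hk : 0 ≤ κ / ((d + 1) * n) := by positivity
  have h1 : κ / ((d + 1) * n) * D ≤ κ / ((d + 1) * n) * (n * T + (n - 1)) := mul_le_mul_of_nonneg_left hDT hk
  have h2 : κ / ((d + 1) * n) * (n * T + (n - 1)) = κ / (d + 1) * T + κ / (d + 1) - κ / ((d + 1) * n) := by
    field_simp
    ring
  linarith

/-! ### §3 Hypotheses `hBst`, `hB` of `decay126_torus`: the positioned decay of `G′Q′^*` and `Q′G′` -/

/-- **`hBst` IN THE MULTIPLIER MODEL** — the factor `G′_kQ′_k^*` (`KRe`, fine × coarse) is a positioned exponentially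
decaying kernel in pv15's carrier: for `0 < a₋ ≤ a₊` there are `κ > 0`, `C ≥ 0` with
`PosDecay dist fineSite corner (KRe n a N) C (κ/((d+1)n))` for every `n = L^k ≥ 1`, `a ∈ [a₋,a₊]` and every unit torus
— rate `κ/((d+1)n)` per FINE lattice step, i.e. `κ/(d+1)` per unit (`ξ`-lattice) length, uniformly in `k` and the
volume (`KRe_decay` + the metric comparison). [cite: Balaban1983RegularityDecay, Lemma 2.4 (2.35) p.582;
Balaban1984PropagatorsI, p.38 "from Lemma 2.4 of [2]"] -/
theorem KRe_posDecay (d : ℕ) (aminus aplus : ℝ) (ha : 0 < aminus) :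
    ∃ κ C : ℝ, 0 < κ ∧ 0 ≤ C ∧ ∀ (n : ℕ) [NeZero n], 1 ≤ n → ∀ a : ℝ, aminus ≤ a → a ≤ aplus →
      ∀ (N : Fin (d + 1) → ℕ) [∀ i, NeZero (N i)],
        PosDecay (fun x y : UT (fun i => n * N i) => dist x y) (fineSite n N) (corner n N) (KRe n a N) C
          (κ / ((d + 1) * n)) := by
  obtain ⟨κ, M, hκ, hM, h⟩ := KRe_decay d aminus aplus ha
  have hpc : 0 ≤ periodConst κ d := by
    unfold periodConst
    apply pow_nonneg
    apply div_nonneg (by positivity)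
    have : Real.exp (-(κ / (d + 1))) < 1 := Real.exp_lt_one_iff.mpr (by
      have : 0 < κ / (d + 1) := div_pos hκ (by positivity)
      linarith)
    linarith
  have hC : 0 ≤ M * periodConst κ d * Real.exp (κ / (d + 1)) := mul_nonneg (mul_nonneg hM hpc) (Real.exp_pos _).le
  refine ⟨κ, M * periodConst κ d * Real.exp (κ / (d + 1)), hκ, hC, fun n _ hn1 a ha1 ha2 N _ => ⟨hC, fun z k => ?_⟩⟩
  have hN : ∀ i, 1 ≤ N i := UT.one_le N
  show |KRe n a N z k| ≤ M * periodConst κ d * Real.exp (κ / (d + 1))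
    * Real.exp (-(κ / ((d + 1) * n) * dist (fineSite n N z) (corner n N k)))
  calc |KRe n a N z k|
      ≤ M * periodConst κ d * Real.exp (-(κ / (d + 1) * torusSupNorm N (coarse n (toZ z) - toZ k))) :=
        h n a ha1 ha2 N hN z k
    _ ≤ M * periodConst κ d * (Real.exp (κ / (d + 1))
          * Real.exp (-(κ / ((d + 1) * n) * dist (fineSite n N z) (corner n N k)))) :=
        mul_le_mul_of_nonneg_left (exp_coarse_le hκ.le d hn1 (dist_fineSite_corner_le n hn1 N z k))
          (mul_nonneg hM hpc)
    _ = M * periodConst κ d * Real.exp (κ / (d + 1))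
          * Real.exp (-(κ / ((d + 1) * n) * dist (fineSite n N z) (corner n N k))) := by ring

/-- **`hB` IN THE MULTIPLIER MODEL** — the factor `Q′_kG′_k` (`QGRe = ξ^{d+1}·KReᵀ`, coarse × fine) is a positioned
exponentially decaying kernel with the same constants (`PosDecay.transpose`, `PosDecay.smul`, `ξ^{d+1} ≤ 1`).
[cite: Balaban1983RegularityDecay, Lemma 2.4 (2.35) p.582; Balaban1984PropagatorsI, p.38 "from Lemma 2.4 of [2]"] -/
theorem QGRe_posDecay (d : ℕ) (aminus aplus : ℝ) (ha : 0 < aminus) :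
    ∃ κ C : ℝ, 0 < κ ∧ 0 ≤ C ∧ ∀ (n : ℕ) [NeZero n], 1 ≤ n → ∀ a : ℝ, aminus ≤ a → a ≤ aplus →
      ∀ (N : Fin (d + 1) → ℕ) [∀ i, NeZero (N i)],
        PosDecay (fun x y : UT (fun i => n * N i) => dist x y) (corner n N) (fineSite n N) (QGRe n a N) C
          (κ / ((d + 1) * n)) := by
  obtain ⟨κ, C, hκ, hC, h⟩ := KRe_posDecay d aminus aplus ha
  refine ⟨κ, C, hκ, hC, fun n _ hn1 a ha1 ha2 N _ => ?_⟩
  have hK := h n hn1 a ha1 ha2 N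
  have hT : PosDecay (fun x y : UT (fun i => n * N i) => dist x y) (corner n N) (fineSite n N) (KRe n a N)ᵀ C
      (κ / ((d + 1) * n)) := hK.transpose (fun x y => dist_comm x y)
  have hS := hT.smul (((n : ℝ) ^ (d + 1))⁻¹)
  have h1 : |((n : ℝ) ^ (d + 1))⁻¹| * C ≤ C := by
    rw [abs_inv, abs_pow, Nat.abs_cast]
    have hle : ((n : ℝ) ^ (d + 1))⁻¹ ≤ 1 := inv_le_one_of_one_le₀ (one_le_pow₀ (by exact_mod_cast hn1))
    exact (mul_le_mul_of_nonneg_right hle hC).trans_eq (one_mul C)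
  exact hS.const_mono h1

/-! ### §4 Hypotheses `hG` (with `G := 1`) and `hM` -/

/-- **`hG` WITH `G := 1`**: the identity matrix on any family positioned in a pseudometric space decays at every rate
with constant `1` (`dist x x = 0`). [folklore] -/
theorem posDecay_one {ι X : Type*} [DecidableEq ι] [PseudoMetricSpace X] (p : ι → X) (δ : ℝ) :
    PosDecay (fun x y : X => dist x y) p p (1 : Matrix ι ι ℝ) 1 δ := by
  refine ⟨zero_le_one, fun a b => ?_⟩
  show |(1 : Matrix ι ι ℝ) a b| ≤ 1 * Real.exp (-(δ * dist (p a) (p b)))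
  by_cases h : a = b
  · subst h
    rw [Matrix.one_apply_eq, abs_one, dist_self, mul_zero, neg_zero, Real.exp_zero, mul_one]
  · rw [Matrix.one_apply_ne h, abs_zero]
    positivity

/-- **ALL OF `hG`, `hB`, `hBst`, `hM` AT ONCE, in the multiplier model, with ONE rate**: for `0 < a₋ ≤ a₊` there are
`κ > 0`, `C ≥ 0`, `γ₀ > 0` such that for every `n = L^k ≥ 1`, `a ∈ [a₋,a₊]` and every unit torus, with
`δ := κ/((d+1)n)`, `ι := Π_μ Fin (nN_μ)` positioned by `fineSite`, `κ := Π_μ Fin N_μ` positioned by `corner`: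
`G := 1`, `B := QGRe`, `Bst := KRe` satisfy the four hypotheses of `B5Decay126.decay126_torus` — so that, in the torus
multiplier model, (1.126) for `∂·(G′Q′^*)·(Q′G′²Q′^*)^{−1}·(Q′G′)·∂^*` needs only the `∂`-kernels `D, D′` and their
finite-range decay (`PosDecay.of_finiteRange`) as further input. [cite: Balaban1984PropagatorsI, (1.126) p.38 ("They
follow from the representation P = G′Q′*(Q′G′²Q′*)⁻¹Q′G′, from Lemma 2.4 of [2], and the representation (1.45) …")] -/
theorem inputs126_multiplier (d : ℕ) (aminus aplus : ℝ) (ha : 0 < aminus) :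
    ∃ κ C γ₀ : ℝ, 0 < κ ∧ 0 ≤ C ∧ 0 < γ₀ ∧ ∀ (n : ℕ) [NeZero n], 1 ≤ n → ∀ a : ℝ, aminus ≤ a → a ≤ aplus →
      ∀ (N : Fin (d + 1) → ℕ) [∀ i, NeZero (N i)],
        PosDecay (fun x y : UT (fun i => n * N i) => dist x y) (fineSite n N) (fineSite n N)
            (1 : Matrix (Idx (fun i => n * N i)) (Idx (fun i => n * N i)) ℝ) 1 (κ / ((d + 1) * n)) ∧
          PosDecay (fun x y : UT (fun i => n * N i) => dist x y) (corner n N) (fineSite n N) (QGRe n a N) C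
            (κ / ((d + 1) * n)) ∧
          PosDecay (fun x y : UT (fun i => n * N i) => dist x y) (fineSite n N) (corner n N) (KRe n a N) C
            (κ / ((d + 1) * n)) ∧
          QGQInverse.Coercive
            (QGRe n a N * (1 : Matrix (Idx (fun i => n * N i)) (Idx (fun i => n * N i)) ℝ)
              * (1 : Matrix (Idx (fun i => n * N i)) (Idx (fun i => n * N i)) ℝ) * KRe n a N) γ₀ := by
  obtain ⟨κ, C, hκ, hC, hK⟩ := KRe_posDecay d aminus aplus ha
  obtain ⟨κ', C', hκ', hC', hQ⟩ := QGRe_posDecay d aminus aplus ha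
  obtain ⟨γ₀, hγ, hco⟩ := coercive_factorised d aminus aplus ha
  -- one rate: the smaller of the two; one constant: the larger of the two
  refine ⟨min κ κ', max C C', γ₀, lt_min hκ hκ', hC.trans (le_max_left _ _), hγ,
    fun n _ hn1 a ha1 ha2 N _ => ⟨posDecay_one _ _, ?_, ?_, hco n hn1 a ha1 ha2 N (UT.one_le N)⟩⟩
  · have h := hQ n hn1 a ha1 ha2 N
    refine (h.mono (fun x y => dist_nonneg) ?_).const_mono (le_max_right _ _)
    exact div_le_div_of_nonneg_right (min_le_right _ _) (by positivity)
  · have h := hK n hn1 a ha1 ha2 N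
    refine (h.mono (fun x y => dist_nonneg) ?_).const_mono (le_max_left _ _)
    exact div_le_div_of_nonneg_right (min_le_left _ _) (by positivity)


/-! ### §5 The direction index: the scalar factors on the vector-field carrier `UT (n·N) × Fin (d+1)` of (1.128) -/

/-- **`G′Q′^*` ON THE VECTOR-FIELD CARRIER**: `h128_of_constituents` indexes the fine side by `UT N′ × Fin (d+1)` (site,
direction; `πf = Prod.fst`), the operator `P` of `∂P∂^*` acting on SCALAR functions (`λ` on `T_ξ`); a scalar is carried
on the direction component `0`, so `G′Q′^*` becomes the padded matrix `((x,μ), k) ↦ [μ = 0]·KRe(x,k)` (and `∂` the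
successor's `((x,μ),(z,λ)) ↦ [λ = 0]·∂_μ(x,z)`). [folklore] -/
def KReV (n : ℕ) [NeZero n] (a : ℝ) (N : Fin (d + 1) → ℕ) :
    Matrix (UT (fun i => n * N i) × Fin (d + 1)) (Idx N) ℝ :=
  Matrix.of fun p k => if p.2 = 0 then KRe n a N (UT.toSite (fun i => n * N i) p.1) k else 0

/-- **`Q′G′` ON THE VECTOR-FIELD CARRIER**: `(k, (x,μ)) ↦ [μ = 0]·QGRe(k,x)`. [folklore] -/
def QGReV (n : ℕ) [NeZero n] (a : ℝ) (N : Fin (d + 1) → ℕ) :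
    Matrix (Idx N) (UT (fun i => n * N i) × Fin (d + 1)) ℝ :=
  Matrix.of fun k p => if p.2 = 0 then QGRe n a N k (UT.toSite (fun i => n * N i) p.1) else 0

/-- the padded product is the scalar product: `QGReV · KReV = QGRe · KRe`. [folklore] -/
theorem QGReV_mul_KReV (n : ℕ) [NeZero n] (a : ℝ) (N : Fin (d + 1) → ℕ) :
    QGReV n a N * KReV n a N = QGRe n a N * KRe n a N := by
  ext k k'
  simp only [Matrix.mul_apply, QGReV, KReV, Matrix.of_apply]
  rw [Fintype.sum_prod_type]
  have hsum : ∀ x : UT (fun i => n * N i), ∑ μ : Fin (d + 1),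
      (if μ = 0 then QGRe n a N k (UT.toSite (fun i => n * N i) x) else 0)
        * (if μ = 0 then KRe n a N (UT.toSite (fun i => n * N i) x) k' else 0)
      = QGRe n a N k (UT.toSite (fun i => n * N i) x) * KRe n a N (UT.toSite (fun i => n * N i) x) k' := by
    intro x
    rw [Finset.sum_eq_single (0 : Fin (d + 1))]
    · rw [if_pos rfl, if_pos rfl]
    · intro μ _ hμ
      rw [if_neg hμ, zero_mul]
    · intro h
      exact absurd (Finset.mem_univ _) h
  simp_rw [hsum]
  rfl

/-- **`hM` ON THE VECTOR-FIELD CARRIER**: `QGReV · 1 · 1 · KReV = qggqRe`, hence coercive with the constant of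
`coercive_factorised`. [folklore] -/
theorem QGReV_one_one_KReV (n : ℕ) [NeZero n] (hn1 : 1 ≤ n) (a : ℝ) (ha : 0 < a) {N : Fin (d + 1) → ℕ}
    (hN : ∀ i, 1 ≤ N i) :
    QGReV n a N * (1 : Matrix (UT (fun i => n * N i) × Fin (d + 1)) (UT (fun i => n * N i) × Fin (d + 1)) ℝ)
        * (1 : Matrix (UT (fun i => n * N i) × Fin (d + 1)) (UT (fun i => n * N i) × Fin (d + 1)) ℝ) * KReV n a N
      = qggqRe n a N := by
  rw [Matrix.mul_one, Matrix.mul_one, QGReV_mul_KReV, QGRe_mul_KRe n hn1 a ha hN]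

/-- **`hBst` ON THE VECTOR-FIELD CARRIER** (rows positioned by `Prod.fst`, columns by `corner`). [folklore] -/
theorem KReV_posDecay {n : ℕ} [NeZero n] {a : ℝ} {N : Fin (d + 1) → ℕ} [∀ i, NeZero (N i)] {C δ : ℝ}
    (h : PosDecay (fun x y : UT (fun i => n * N i) => dist x y) (fineSite n N) (corner n N) (KRe n a N) C δ) :
    PosDecay (fun x y : UT (fun i => n * N i) => dist x y) Prod.fst (corner n N) (KReV n a N) C δ := by
  refine ⟨h.1, fun p k => ?_⟩
  show |KReV n a N p k| ≤ C * Real.exp (-(δ * dist p.1 (corner n N k)))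
  have hp := h.2 (UT.toSite (fun i => n * N i) p.1) k
  by_cases hμ : p.2 = 0
  · simp only [KReV, Matrix.of_apply, if_pos hμ]
    exact hp
  · simp only [KReV, Matrix.of_apply, if_neg hμ, abs_zero]
    exact mul_nonneg h.1 (Real.exp_pos _).le

/-- **`hB` ON THE VECTOR-FIELD CARRIER** (rows positioned by `corner`, columns by `Prod.fst`). [folklore] -/
theorem QGReV_posDecay {n : ℕ} [NeZero n] {a : ℝ} {N : Fin (d + 1) → ℕ} [∀ i, NeZero (N i)] {C δ : ℝ}
    (h : PosDecay (fun x y : UT (fun i => n * N i) => dist x y) (corner n N) (fineSite n N) (QGRe n a N) C δ) :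
    PosDecay (fun x y : UT (fun i => n * N i) => dist x y) (corner n N) Prod.fst (QGReV n a N) C δ := by
  refine ⟨h.1, fun k p => ?_⟩
  show |QGReV n a N k p| ≤ C * Real.exp (-(δ * dist (corner n N k) p.1))
  have hp := h.2 k (UT.toSite (fun i => n * N i) p.1)
  by_cases hμ : p.2 = 0
  · simp only [QGReV, Matrix.of_apply, if_pos hμ]
    exact hp
  · simp only [QGReV, Matrix.of_apply, if_neg hμ, abs_zero]
    exact mul_nonneg h.1 (Real.exp_pos _).le

/-- **THE INPUTS OF `h128_of_constituents` IN THE MULTIPLIER MODEL** — with `ι = UT (n·N) × Fin (d+1)` (`πf = Prod.fst`),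
`κ = Π_μ Fin N_μ` (`σ = corner`, fibres `≤ 1`: `fibre_card_corner`), `G := 1`, `B := QGReV`, `Bst := KReV`: for
`0 < a₋ ≤ a₊` there are `κ₀ > 0`, `C ≥ 0`, `γ₀ > 0` such that for all `n = L^k ≥ 1`, `a ∈ [a₋,a₊]`, `N`, with the rate
`δ = κ₀/((d+1)n)`, the hypotheses `hG`, `hB`, `hBst`, `hco` of `B5Decay126.h128_of_constituents` hold — leaving as inputs
of the torus-model (1.128) leaf ONLY the `∂`-kernels `D, D′` (finite range) and the Dirichlet-form operator `Dg`.
[cite: Balaban1984PropagatorsI, (1.128) p.38 with (1.126) p.38 ("from the representation P = G′Q′*(Q′G′²Q′*)⁻¹Q′G′,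
from Lemma 2.4 of [2], and the representation (1.45)")] -/
theorem inputs128_multiplier (d : ℕ) (aminus aplus : ℝ) (ha : 0 < aminus) :
    ∃ κ₀ C γ₀ : ℝ, 0 < κ₀ ∧ 0 ≤ C ∧ 0 < γ₀ ∧ ∀ (n : ℕ) [NeZero n], 1 ≤ n → ∀ a : ℝ, aminus ≤ a → a ≤ aplus →
      ∀ (N : Fin (d + 1) → ℕ) [∀ i, NeZero (N i)],
        PosDecay (fun x y : UT (fun i => n * N i) => dist x y) Prod.fst Prod.fst
            (1 : Matrix (UT (fun i => n * N i) × Fin (d + 1)) (UT (fun i => n * N i) × Fin (d + 1)) ℝ) 1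
            (κ₀ / ((d + 1) * n)) ∧
          PosDecay (fun x y : UT (fun i => n * N i) => dist x y) (corner n N) Prod.fst (QGReV n a N) C
            (κ₀ / ((d + 1) * n)) ∧
          PosDecay (fun x y : UT (fun i => n * N i) => dist x y) Prod.fst (corner n N) (KReV n a N) C
            (κ₀ / ((d + 1) * n)) ∧
          QGQInverse.Coercive
            (QGReV n a N
              * (1 : Matrix (UT (fun i => n * N i) × Fin (d + 1)) (UT (fun i => n * N i) × Fin (d + 1)) ℝ)
              * (1 : Matrix (UT (fun i => n * N i) × Fin (d + 1)) (UT (fun i => n * N i) × Fin (d + 1)) ℝ)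
              * KReV n a N) γ₀ := by
  obtain ⟨κ₀, C, γ₀, hκ, hC, hγ, h⟩ := inputs126_multiplier d aminus aplus ha
  refine ⟨κ₀, C, γ₀, hκ, hC, hγ, fun n _ hn1 a ha1 ha2 N _ => ?_⟩
  obtain ⟨-, hB, hBst, hco⟩ := h n hn1 a ha1 ha2 N
  refine ⟨posDecay_one _ _, QGReV_posDecay hB, KReV_posDecay hBst, ?_⟩
  rw [QGReV_one_one_KReV n hn1 a (lt_of_lt_of_le ha ha1) (UT.one_le N)]
  rw [QGRe_one_one_KRe n hn1 a (lt_of_lt_of_le ha ha1) (UT.one_le N)] at hco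
  exact hco


/-! ### §6 (1.126) in the torus multiplier model: only the `∂`-kernels remain as inputs -/

/-- the identity matrix on the vector-field carrier (the engine's `G`, here `:= 1`). [folklore] -/
abbrev OneV (n : ℕ) (N : Fin (d + 1) → ℕ) :
    Matrix (UT (fun i => n * N i) × Fin (d + 1)) (UT (fun i => n * N i) × Fin (d + 1)) ℝ := 1

/-- the inverse in the padded factorisation is pv17's real kernel: `(QGReV·1·1·KReV)⁻¹ = kerRe = Re 𝒢^M`. [folklore] -/
theorem inv_padded (n : ℕ) [NeZero n] (hn1 : 1 ≤ n) (a : ℝ) (ha : 0 < a) {N : Fin (d + 1) → ℕ}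
    (hN : ∀ i, 1 ≤ N i) : (QGReV n a N * OneV n N * OneV n N * KReV n a N)⁻¹ = kerRe n a N := by
  rw [OneV, QGReV_one_one_KReV n hn1 a ha hN, qggqRe_inv n hn1 a ha hN]

/-- **(1.126) IN THE TORUS MULTIPLIER MODEL, DOWN TO THE `∂`-KERNELS** — `B5Decay126.decay126_torus` with `G := 1`,
`B := QGReV` (`Q′G′`), `Bst := KReV` (`G′Q′^*`), their positioned decays (`inputs128_multiplier`, from b04's Lemma 2.4 on
the torus) and the coercivity `γ₀ ≤ Q′G′²Q′^*` (`coercive_factorised`, from pv17's (1.45) strip bounds) ALL DISCHARGED: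
for `0 < a₋ ≤ a₊` there are `κ₀ > 0`, `C ≥ 0`, `γ₀ > 0` such that for every `n = L^k ≥ 1`, `a ∈ [a₋,a₊]`, every unit
torus, and ANY kernels `D, D′` on the vector-field carrier decaying at the rate `δ = κ₀/((d+1)n)` (read: `∂`, `∂^*`,
finite range — `PosDecay.of_finiteRange`), the kernel `D·(G′Q′^*)·(Q′G′²Q′^*)^{−1}·(Q′G′)·D′` (= `∂P∂^*`,
`P = G′Q′^*(Q′G′²Q′^*)^{−1}Q′G′`) decays: `|·(i,j)| ≤ torusConst126 · e^{−torusRate126 · dist(i.1, j.1)}` with pv15's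
explicit constant and rate at fibre sizes `m₁ = d+1`, `m₂ = 1` and `c_G = 1`, `c_B = c_{B⋆} = C`.
[cite: Balaban1984PropagatorsI, (1.126) p.38 ("They follow from the representation P = G′Q′*(Q′G′²Q′*)⁻¹Q′G′, from
Lemma 2.4 of [2], and the representation (1.45) and the analyticity method of proving an exponential decay")] -/
theorem decay126_multiplier (d : ℕ) (aminus aplus : ℝ) (ha : 0 < aminus) :
    ∃ κ₀ C γ₀ : ℝ, 0 < κ₀ ∧ 0 ≤ C ∧ 0 < γ₀ ∧ ∀ (n : ℕ) [NeZero n], 1 ≤ n → ∀ a : ℝ, aminus ≤ a → a ≤ aplus →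
      ∀ (N : Fin (d + 1) → ℕ) [∀ i, NeZero (N i)]
        (D D' : Matrix (UT (fun i => n * N i) × Fin (d + 1)) (UT (fun i => n * N i) × Fin (d + 1)) ℝ) (cD cD' : ℝ),
        PosDecay (fun x y : UT (fun i => n * N i) => dist x y) Prod.fst Prod.fst D cD (κ₀ / ((d + 1) * n)) →
        PosDecay (fun x y : UT (fun i => n * N i) => dist x y) Prod.fst Prod.fst D' cD' (κ₀ / ((d + 1) * n)) →
          PosDecay (fun x y : UT (fun i => n * N i) => dist x y) Prod.fst Prod.fst
            (D * OneV n N * KReV n a N * (QGReV n a N * OneV n N * OneV n N * KReV n a N)⁻¹ * QGReV n a N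
              * OneV n N * D')
            (torusConst126 (d + 1) (d + 1) 1 cD cD' 1 C C γ₀ (κ₀ / ((d + 1) * n)))
            (torusRate126 (d + 1) (d + 1) 1 1 C C γ₀ (κ₀ / ((d + 1) * n))) := by
  obtain ⟨κ₀, C, γ₀, hκ, hC, hγ, h⟩ := inputs128_multiplier d aminus aplus ha
  refine ⟨κ₀, C, γ₀, hκ, hC, hγ, fun n _ hn1 a ha1 ha2 N _ D D' cD cD' hD hD' => ?_⟩
  obtain ⟨hG, hB, hBst, hco⟩ := h n hn1 a ha1 ha2 N
  have hδ : 0 < κ₀ / ((d + 1) * n) := by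
    have : (0 : ℝ) < n := by exact_mod_cast hn1
    positivity
  exact decay126_torus (B5AveragingTorus.fibre_card_fst (N := fun i => n * N i)) (fibre_card_corner n N) hδ hγ
    hG hD hD' hB hBst hco

/-- `0 < torusRate126` for these data (for the (1.128) assembly `h128_of_constituents` / `twoDelta0`). [folklore] -/
theorem decay126_multiplier_rate_pos (d : ℕ) {C γ₀ κ₀ : ℝ} (hC : 0 ≤ C) (hγ : 0 < γ₀) (hκ : 0 < κ₀) {n : ℕ}
    (hn1 : 1 ≤ n) : 0 < torusRate126 (d + 1) (d + 1) 1 1 C C γ₀ (κ₀ / ((d + 1) * n)) := by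
  have : (0 : ℝ) < n := by exact_mod_cast hn1
  exact torusRate126_pos (d + 1) (d + 1) 1 zero_le_one hC hC hγ (by positivity)


/-! ### §7 (1.128) in the torus multiplier model: inputs = the `∂`-kernels and the Dirichlet operator only -/

/-- **(1.128) IN THE TORUS MULTIPLIER MODEL WITH (1.126) DISCHARGED DOWN TO `∂`** — pv15's `h128_of_constituents`
(B5 (1.128) for `Δ_a = Δ + aQ^*Q − ∂P∂^*` on the torus, smooth partition of cube size `M₀`, `2M₀ ≤ nN_μ`) with
`G := 1`, `B := QGReV`, `Bst := KReV`, `σ := corner` and the hypotheses `hG`, `hB`, `hBst`, `hco`, `hm₂` supplied by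
this file: what is left as input is the vector-field Dirichlet operator `Dg`, the coefficient `a′` of `aQ^*Q`, and the
`∂`-kernels `D, D′` with their decay at rate `κ₀/((d+1)n)`.  NO coercivity and NO Green-function hypothesis remains.
[cite: Balaban1984PropagatorsI, (1.128) p.38 with (1.126) p.38 and p.26 (γ₀ ≦ Q′_kG′_k²Q′_k^*)] -/
theorem h128_multiplier (d : ℕ) (aminus aplus : ℝ) (ha : 0 < aminus) :
    ∃ κ₀ C γ₀ : ℝ, 0 < κ₀ ∧ 0 ≤ C ∧ 0 < γ₀ ∧ ∀ (n : ℕ) [NeZero n], 1 ≤ n → ∀ a : ℝ, aminus ≤ a → a ≤ aplus →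
      ∀ (N : Fin (d + 1) → ℕ) [∀ i, NeZero (N i)] (M₀ : ℕ), 1 ≤ M₀ → (∀ i, 2 * M₀ ≤ n * N i) →
        ∀ (Dg : Module.End ℝ (EuclideanSpace ℝ (UT (fun i => n * N i) × Fin (d + 1)))),
          (∀ A, Real.sqrt (B5Leibniz121.dirichlet
              (B5Leibniz121.axisWC (N := fun i => n * N i) (κ := Fin (d + 1))) A) ≤ ‖Dg A‖) →
        ∀ (a' : ℝ) (D D' : Matrix (UT (fun i => n * N i) × Fin (d + 1)) (UT (fun i => n * N i) × Fin (d + 1)) ℝ)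
          (cD cD' : ℝ),
          PosDecay (fun x y : UT (fun i => n * N i) => dist x y) Prod.fst Prod.fst D cD (κ₀ / ((d + 1) * n)) →
          PosDecay (fun x y : UT (fun i => n * N i) => dist x y) Prod.fst Prod.fst D' cD' (κ₀ / ((d + 1) * n)) →
          ∀ (z₁ z₂ : B5TorusCover.Ctr (fun i => n * N i) M₀)
            (A : EuclideanSpace ℝ (UT (fun i => n * N i) × Fin (d + 1))),
            ‖B5SmoothPartition.HSop (fun i => n * N i) M₀ (fun p : UT (fun i => n * N i) × Fin (d + 1) => p.1) z₁
                (B5Local114.Kop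
                  (B5Commutator128.kerOp (fun i j => B5Leibniz121.lapKer B5Leibniz121.axisWC i j
                      + a' * B5Averaging120.gram120 ((n : ℝ) ^ (d + 1)) (B5AveragingTorus.avgKer n) i j)
                    + B5Commutator128.kerOp (fun i j =>
                        -((D * OneV n N * KReV n a N * (QGReV n a N * OneV n N * OneV n N * KReV n a N)⁻¹
                            * QGReV n a N * OneV n N * D') i j)))
                  (B5SmoothPartition.HSop (fun i => n * N i) M₀
                    (fun p : UT (fun i => n * N i) × Fin (d + 1) => p.1)) z₂ A)‖
              ≤ (((4 * ((d + 1 : ℕ) : ℝ) / M₀ * Real.sqrt (2 * ((d + 1 : ℕ) : ℝ))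
                        + 52 * ((d + 1 : ℕ) : ℝ) / (M₀ : ℝ) ^ 2)
                      + 4 * ((d + 1 : ℕ) : ℝ) / M₀ * (4 * n) * |a'|) * Real.exp (4 + 4 * n / M₀)
                  + 4 * ((d + 1 : ℕ) : ℝ) / M₀
                    * torusConst126 (d + 1) (d + 1) 1 cD cD' 1 C C γ₀ (κ₀ / ((d + 1) * n))
                    * (24 / (Real.exp 1 * torusRate126 (d + 1) (d + 1) 1 1 C C γ₀ (κ₀ / ((d + 1) * n))))
                    * (((d + 1 : ℕ) : ℝ) * B4Sect5Proof.latticeConst (d + 1)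
                        (torusRate126 (d + 1) (d + 1) 1 1 C C γ₀ (κ₀ / ((d + 1) * n)) / 8)) * Real.exp 7)
                * Real.exp (-(B5Walk131.twoDelta0 (torusRate126 (d + 1) (d + 1) 1 1 C C γ₀ (κ₀ / ((d + 1) * n))) M₀
                    * dist (B5TorusCover.ctrU (fun i => n * N i) M₀ z₁)
                        (B5TorusCover.ctrU (fun i => n * N i) M₀ z₂)))
                * (‖Dg A‖ + ‖A‖) := by
  obtain ⟨κ₀, C, γ₀, hκ, hC, hγ, h⟩ := inputs128_multiplier d aminus aplus ha
  refine ⟨κ₀, C, γ₀, hκ, hC, hγ,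
    fun n _ hn1 a ha1 ha2 N _ M₀ hM h2N Dg hDg a' D D' cD cD' hD hD' z₁ z₂ A => ?_⟩
  obtain ⟨hG, hB, hBst, hco⟩ := h n hn1 a ha1 ha2 N
  have hδ : 0 < κ₀ / ((d + 1) * n) := by
    have : (0 : ℝ) < n := by exact_mod_cast hn1
    positivity
  have hq : ∀ i, 1 ≤ (fun i => n * N i) i / n := fun i => by
    show 1 ≤ n * N i / n
    rw [Nat.mul_div_cancel_left _ (NeZero.pos n)]
    exact UT.one_le N i
  exact h128_of_constituents hM h2N hn1 hq hDg a' (fibre_card_corner n N) hδ hγ hG hD hD' hB hBst hco z₁ z₂ A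

end

end Literature.MathematicalPhysics.QuantumFieldTheory.Balaban1983to89.B5QGGQ145Position
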